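import Literature.NumberTheory.DiophantineGeometry.AbcShapeFactorisation
import Literature.NumberTheory.DiophantineGeometry.AbcHitCountUpperBoundProofs
import HarnessLib

/-!
# Five-variable shapes `n = x₁ x₂² x₃³ x₄⁴ r` and the tail sets `{r : rad r ∼ ρ}`

Topic `NumberTheory/DiophantineGeometry`; auxiliary file for the proof of
`Literature.NumberTheory.DiophantineGeometry.bernertEtAl2024_thm_1_2`
(Bernert–Browning–Lichtman–Teräväinen, arXiv:2410.12234 v2, Theorem 1.2), assembled in
`AbcExceptionalSetBoundsThm12Proofs`.

The source factors `a, b, c` into shapes `c ∏_{j ≤ d} x_j^j` with `d = d(ε)` variables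
([cite: BernertEtAl2024, Lemma 2.2], proved in `AbcShapeFactorisation`). For Theorem 1.2 only the
exponents `j ≤ 4` are ever used individually (geometry of numbers in `x₁`, fourth moments in
`x₂, x₃, x₄`, and the weights `P₁⁴P₂³P₃²P₄` of the endgame [cite: Bernert2025, §4]), so here the
shape is truncated at `d = 4` with an honest *tail*:

* `exists_fiveShape`: every `n ≥ 1` is `x₁ x₂² x₃³ x₄⁴ r` with `x_i = ∏_{p^i ∥ n} p`
  (`AbcShapes.exactRadical n i`) and `r = ∏_{p^m ∥ n, m ≥ 5} p^m`, so that
  `rad n = x₁ x₂ x₃ x₄ rad r` and `(rad r)^5 ≤ r`;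
* `card_tailSet_le`: `#{r ≤ C : ρ ≤ rad r < 2ρ} ≤ K_δ C^δ ρ^{1+δ}` (from the radical-fibre bound
  `AbcHits.card_radFibre_le` of `AbcHitCountUpperBoundProofs`, i.e. Rankin's trick), which replaces
  the box `∏_{j ≥ 5} [X_j, 2X_j)` of the source by a set of the same size up to `C^δ`.

No definitions are introduced.
-/

open Finset UniqueFactorizationMonoid

namespace Literature.NumberTheory.DiophantineGeometry

namespace AbcExceptional

/-! ### Prime factorisation of `∏_{p ∈ S} p^{e p}` -/

/-- `v_r(∏_{p ∈ S} p^{e_p}) = e_r` for `r ∈ S` (primes), `0` otherwise. [folklore] -/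
theorem factorization_prod_prime_pow {S : Finset ℕ} (hS : ∀ p ∈ S, p.Prime) (e : ℕ → ℕ)
    (r : ℕ) : (∏ p ∈ S, p ^ e p).factorization r = if r ∈ S then e r else 0 := by
  rw [Nat.factorization_prod fun p hp => pow_ne_zero _ (hS p hp).ne_zero, Finset.sum_apply']
  have : ∀ p ∈ S, (p ^ e p).factorization r = if p = r then e p else 0 := by
    intro p hp
    rw [(hS p hp).factorization_pow, Finsupp.single_apply]
  rw [Finset.sum_congr rfl this, Finset.sum_ite_eq']

/-- The prime factors of `∏_{p ∈ S} p^{e_p}` (`S` primes, `e_p ≥ 1`) are `S`. [folklore] -/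
theorem primeFactors_prod_prime_pow {S : Finset ℕ} (hS : ∀ p ∈ S, p.Prime) {e : ℕ → ℕ}
    (he : ∀ p ∈ S, e p ≠ 0) : (∏ p ∈ S, p ^ e p).primeFactors = S := by
  ext r
  rw [← Nat.support_factorization, Finsupp.mem_support_iff, factorization_prod_prime_pow hS e r]
  constructor
  · intro h
    by_contra hr
    rw [if_neg hr] at h
    exact h rfl
  · intro hr
    rw [if_pos hr]
    exact he r hr

/-! ### The five-variable shape -/

open AbcShapes in
/-- **Five-variable shape.** Every `n ≥ 1` factors as `n = x₁ x₂² x₃³ x₄⁴ r` with positive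
`x_i, r` such that `rad n = x₁ x₂ x₃ x₄ · rad r` and `(rad r)^5 ≤ r`: take `x_i = ∏_{p^i ∥ n} p`
and `r = ∏_{p^m ∥ n, m ≥ 5} p^m`. (Truncation at `d = 4` of the shapes of
[BernertEtAl2024, Lemma 2.2].) [folklore] -/
theorem exists_fiveShape {n : ℕ} (hn : n ≠ 0) :
    ∃ x₁ x₂ x₃ x₄ r : ℕ, 0 < x₁ ∧ 0 < x₂ ∧ 0 < x₃ ∧ 0 < x₄ ∧ 0 < r ∧
      x₁ * x₂ ^ 2 * x₃ ^ 3 * x₄ ^ 4 * r = n ∧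
      x₁ * x₂ * x₃ * x₄ * radical r = radical n ∧ radical r ^ 5 ≤ r := by
  classical
  set f := n.factorization with hf
  set S := n.primeFactors with hS
  have hSprime : ∀ p ∈ S, p.Prime := fun p hp => Nat.prime_of_mem_primeFactors hp
  have hfpos : ∀ p ∈ S, 1 ≤ f p := fun p hp =>
    (Nat.prime_of_mem_primeFactors hp).factorization_pos_of_dvd hn (Nat.dvd_of_mem_primeFactors hp)
  set P : Finset ℕ := S.filter (fun p => 5 ≤ f p) with hP
  have hPS : P ⊆ S := filter_subset _ _
  have hPprime : ∀ p ∈ P, p.Prime := fun p hp => hSprime p (hPS hp)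
  set r : ℕ := ∏ p ∈ P, p ^ f p with hr
  have hr0 : 0 < r := prod_pos fun p hp => pow_pos (hPprime p hp).pos _
  have hrP : r.primeFactors = P :=
    primeFactors_prod_prime_pow hPprime (fun p hp => by have := (mem_filter.mp hp).2; omega)
  have hradr : radical r = ∏ p ∈ P, p := by rw [Nat.radical_eq_prod_primeFactors, hrP]
  -- pointwise identities behind the two product formulas
  have key1 : ∀ p ∈ S, p ^ f p = (if f p = 1 then p else 1) * (if f p = 2 then p else 1) ^ 2 *
      (if f p = 3 then p else 1) ^ 3 * (if f p = 4 then p else 1) ^ 4 *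
      (if 5 ≤ f p then p ^ f p else 1) := by
    intro p hp
    have h1 := hfpos p hp
    rcases (show f p = 1 ∨ f p = 2 ∨ f p = 3 ∨ f p = 4 ∨ 5 ≤ f p by omega) with h | h | h | h | h
    · simp [h]
    · simp [h]
    · simp [h]
    · simp [h]
    · have h1' : f p ≠ 1 := by omega
      have h2' : f p ≠ 2 := by omega
      have h3' : f p ≠ 3 := by omega
      have h4' : f p ≠ 4 := by omega
      simp [h, h1', h2', h3', h4']
  have key2 : ∀ p ∈ S, p = (if f p = 1 then p else 1) * (if f p = 2 then p else 1) *
      (if f p = 3 then p else 1) * (if f p = 4 then p else 1) * (if 5 ≤ f p then p else 1) := by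
    intro p hp
    have h1 := hfpos p hp
    rcases (show f p = 1 ∨ f p = 2 ∨ f p = 3 ∨ f p = 4 ∨ 5 ≤ f p by omega) with h | h | h | h | h
    · simp [h]
    · simp [h]
    · simp [h]
    · simp [h]
    · have h1' : f p ≠ 1 := by omega
      have h2' : f p ≠ 2 := by omega
      have h3' : f p ≠ 3 := by omega
      have h4' : f p ≠ 4 := by omega
      simp [h, h1', h2', h3', h4']
  have e : ∀ i, exactRadical n i = ∏ p ∈ S, if f p = i then p else 1 := fun i => by
    rw [exactRadical_def, prod_filter]
  refine ⟨exactRadical n 1, exactRadical n 2, exactRadical n 3, exactRadical n 4, r,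
    exactRadical_pos _ _, exactRadical_pos _ _, exactRadical_pos _ _, exactRadical_pos _ _, hr0,
    ?_, ?_, ?_⟩
  · -- `x₁ x₂² x₃³ x₄⁴ r = n`
    have er : r = ∏ p ∈ S, if 5 ≤ f p then p ^ f p else 1 := by rw [hr, hP, prod_filter]
    rw [e 1, e 2, e 3, e 4, er, ← prod_pow, ← prod_pow, ← prod_pow, ← prod_mul_distrib,
      ← prod_mul_distrib, ← prod_mul_distrib, ← prod_mul_distrib]
    conv_rhs => rw [← Nat.prod_factorization_pow_eq_self hn]
    rw [Finsupp.prod, Nat.support_factorization]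
    exact prod_congr rfl (fun p hp => (key1 p hp).symm)
  · -- `x₁ x₂ x₃ x₄ rad r = rad n`
    have er : radical r = ∏ p ∈ S, if 5 ≤ f p then p else 1 := by rw [hradr, hP, prod_filter]
    rw [e 1, e 2, e 3, e 4, er, ← prod_mul_distrib, ← prod_mul_distrib, ← prod_mul_distrib,
      ← prod_mul_distrib, Nat.radical_eq_prod_primeFactors]
    exact prod_congr rfl (fun p hp => (key2 p hp).symm)
  · -- `(rad r)^5 ≤ r`
    rw [hradr, hr, ← prod_pow]
    exact prod_le_prod (fun p _ => Nat.zero_le _) fun p hp =>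
      Nat.pow_le_pow_right (hPprime p hp).pos (mem_filter.mp hp).2

/-! ### The tail sets -/

/-- **Tail sets are small**: for `δ > 0` there is `K` with
`#{r ∈ [1, C] : ρ ≤ rad r < 2ρ} ≤ K C^δ ρ^{1+δ}` for all `C` and `ρ ≥ 1` (sum the radical-fibre
bound `#{r ≤ C : rad r = s} ≤ K_δ C^δ s^δ` of `AbcHits.card_radFibre_le` over `s ∈ [ρ, 2ρ)`).
[folklore] -/
theorem card_tailSet_le {δ : ℝ} (hδ : 0 < δ) :
    ∃ K : ℝ, 0 < K ∧ ∀ C ρ : ℕ, 1 ≤ ρ →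
      (#{r ∈ Icc 1 C | ρ ≤ radical r ∧ radical r < 2 * ρ} : ℝ) ≤
        K * (C : ℝ) ^ δ * (ρ : ℝ) ^ (1 + δ) := by
  classical
  obtain ⟨K, hK, hKr⟩ := AbcHits.card_radFibre_le hδ
  refine ⟨K * (2 : ℝ) ^ δ, by positivity, fun C ρ hρ => ?_⟩
  have hfib : #{r ∈ Icc 1 C | ρ ≤ radical r ∧ radical r < 2 * ρ} =
      ∑ s ∈ Ico ρ (2 * ρ), #{r ∈ Icc 1 C | radical r = s} := by
    rw [card_eq_sum_card_fiberwise (f := fun r => radical r) (t := Ico ρ (2 * ρ)) ?_]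
    · refine sum_congr rfl (fun s hs => ?_)
      congr 1
      ext r
      simp only [mem_filter, mem_Ico] at hs ⊢
      constructor
      · rintro ⟨⟨h1, -⟩, h3⟩
        exact ⟨h1, h3⟩
      · rintro ⟨h1, h3⟩
        exact ⟨⟨h1, by rw [h3]; exact hs⟩, h3⟩
    · intro r hr
      have h := (mem_filter.mp (Finset.mem_coe.mp hr)).2
      exact Finset.mem_coe.mpr (mem_Ico.mpr h)
  have hρ0 : (0 : ℝ) < ρ := by exact_mod_cast hρ
  rw [hfib]
  push_cast
  calc ∑ s ∈ Ico ρ (2 * ρ), (#{r ∈ Icc 1 C | radical r = s} : ℝ)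
      ≤ ∑ s ∈ Ico ρ (2 * ρ), K * (C : ℝ) ^ δ * ((2 * ρ : ℕ) : ℝ) ^ δ := by
        refine sum_le_sum (fun s hs => ?_)
        have hs' := mem_Ico.mp hs
        calc (#{r ∈ Icc 1 C | radical r = s} : ℝ) ≤ K * (C : ℝ) ^ δ * (s : ℝ) ^ δ :=
              hKr C s (by omega)
          _ ≤ K * (C : ℝ) ^ δ * ((2 * ρ : ℕ) : ℝ) ^ δ := by
              gcongr
              exact_mod_cast hs'.2.le
    _ = (ρ : ℝ) * (K * (C : ℝ) ^ δ * ((2 * ρ : ℕ) : ℝ) ^ δ) := by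
        rw [sum_const, Nat.card_Ico, nsmul_eq_mul]
        have : 2 * ρ - ρ = ρ := by omega
        rw [this]
    _ = K * (2 : ℝ) ^ δ * (C : ℝ) ^ δ * (ρ : ℝ) ^ (1 + δ) := by
        push_cast
        rw [Real.mul_rpow (by norm_num) hρ0.le, Real.rpow_add hρ0, Real.rpow_one]
        ring

end AbcExceptional

end Literature.NumberTheory.DiophantineGeometry
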